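import Literature.NumberTheory.EllipticCurves.CastellaGrossiLeeSkinner2022.AnticyclotomicControl
import Literature.NumberTheory.EllipticCurves.ModularCurve
import HarnessLib

/-!
# Castella–Grossi–Lee–Skinner 2022: Thm. 4.2.2 (the anticyclotomic Iwasawa–Greenberg main
# conjecture for `𝔛_E`, proved) AT THE TRIVIAL CHARACTER, combined with Thm. 5.1.3 (the
# Bertolini–Darmon–Prasanna formula) — display (5.4) of the proof of Thm. 5.3.1 with `𝓛_E(0)`
# evaluated: `𝓕_E(0) = u · c_E⁻² (1 − a_p p⁻¹ + p⁻¹)² log_{ω_E}(P_K)²`, ON THE LITERATURE OBJECT `𝔛_E`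

HONEST FRAMING (cell `b2b-bsdres`, run/shared/lean/b2b/bsd-rank1-residual/; page 1 everywhere):
the goal of the cell is to DELETE the COMBINATION-SHAPED residual classes of the BSD formula for ALL
analytic-rank `≤ 1` curves over `ℚ` from PUBLISHED theorems only, so that the remainder becomes
exactly the CONSTRUCTION-SHAPED classes, which are TYPED, not attempted; this is not "finishing
BSD". This file vendors ONE published statement as a named fact (`def … : Prop`, nothing asserted;
D-0014/D-0026) and PROVES its bookkeeping consumers. Unit `b2b-bsdres-lit-cgls` (off-peak
literature typer, source = Castella–Grossi–Lee–Skinner 2022 and Greenberg–Vatsal 2000), session 6,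
sized ask S1b of the seat's deliverable `HOME/b2b-bsdres-lit-cgls/CGLS-GV-TYPING.md` §6/§12.11.

## What and why

The covered rank-one Eisenstein row C6 of the cell rests, at main-conjecture level, on display
(5.5) of the proof of CGLS Thm. 5.3.1 (registry A157, `display55_sha_heegnerIndex`), which the paper
derives from THREE numbered theorems about ONE `Λ`-module `𝔛_E` — Thm. 4.2.2 (the anticyclotomic
Iwasawa–Greenberg / BDP main conjecture, PROVED there), Thm. 5.1.1 (anticyclotomic control) and
Thm. 5.1.3 (the BDP formula at the trivial character). Session 5 gave `𝔛_E` a Literature home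
(`Castella2018/AnticyclotomicSelmerDual.lean`: `AcSelmer.XAc`) and vendored Thm. 5.1.1 on it
(`AnticyclotomicControl.lean`, A170). This file vendors the OTHER half: exactly what the printed proof
extracts from Thm. 4.2.2 — display (5.4), "`𝓕_E(0) = u · 𝓛_E(0)` for a `p`-adic unit `u`" — with
`𝓛_E(0)` evaluated by Thm. 5.1.3. The BDP `p`-adic `L`-function `𝓛_E ∈ Λ^ur` itself (Thm. 2.1.1:
"characterized by" an interpolation property at Hecke characters of infinity type `(n,−n)`) has no
Literature object; at the trivial character it enters the proof ONLY through its value, which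
Thm. 5.1.3 expresses in tree objects (Manin constant, `a_p`, the formal logarithm of the Heegner
point). With A170 and this fact, (5.5) = A157 is a THEOREM (adapter in
`Summits/BirchSwinnertonDyer/Rank1Residual/Partition/MainConjecturesEisensteinBDP.lean`), and with it
everything the cell hangs on (5.5): (5.7) = A149, CGLS Thm. F = A52, CGS 2025 Thm. D = A47.

## Citation header (read by this seat on the arXiv TeX source of v2 = the FINAL arXiv version,
## 2021-09-14, "Final version, to appear in Invent. Math." — the text of the version of record —,
## `Eisenstein.tex`, kept under `HOME/b2b-bsdres-lit-cgls/src/cgls22-v2final/` with SHA256SUMS;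
## numbering: `\thetheorem = section.subsection.theorem`, §1 = "Algebraic side", …, §5 = "Proof of
## Theorem E and Theorem F"; checked against CGS 2025's citations "[CGLS, Thm. 2.1.1 / 4.2.2 / 5.3.1]")

* Authors: Francesc Castella, Giada Grossi, Jaehoon Lee, Christopher Skinner.
* Title: *On the anticyclotomic Iwasawa theory of rational elliptic curves at Eisenstein primes*.
* Venue: Invent. Math. **227** (2022) 517–580, doi:10.1007/s00222-021-01072-y = arXiv:2008.02571v2
  (bib key `CastellaGrossiLeeSkinner2022`). REFEREED / PUBLISHED.
* Setting (Intro L205–L216; §1 L479–L487, verbatim): "`p = v v̄` splits in `K`, where `v` denotes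
  the prime of `K` above `p` induced by a fixed embedding `ℚ̄ ↪ ℚ̄_p`"; "every prime `ℓ | N` splits in
  `K`" (Heeg); "`Λ := ℤ_p⟦Γ⟧`, `Λ_ac := Λ ⊗ ℚ_p`, `Λ^ur := Λ ⊗̂ ℤ_p^ur`, where `ℤ_p^ur` is the
  completion of the ring of integers of the maximal unramified extension of `ℚ_p`. Following the work
  of Bertolini–Darmon–Prasanna, there is a `p`-adic `L`-function `𝓛_E ∈ Λ^ur` …"; `𝔛_E` = the
  Pontryagin dual of the Selmer group "obtained from `Sel_{p^∞}(E/K_∞)` by relaxing (resp. imposing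
  triviality) at the places above `v` (resp. `v̄`)" (L229–L234; §1.4 L857 `𝔛_E := H¹_{𝓕_Gr}(K,M_E)^∨`).
* **Theorem 4.2.2** (TeX `thm:thmA`, L2332–L2341, = Theorem C of the Introduction), verbatim:
  "Suppose `K` satisfies hypotheses (Heeg), (spl), (disc), and (Sel), and that
  `E[p]^{ss} = 𝔽_p(φ) ⊕ 𝔽_p(ψ)` as `G_ℚ`-modules, with `φ|_{G_p} ≠ 𝟙, ω`. Then `𝔛_E` is
  `Λ`-torsion, and `char_Λ(𝔛_E)Λ^ur = (𝓛_E)` as ideals in `Λ^ur`." Here (disc) = "the discriminant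
  `D_K` of `K` is odd and `D_K ≠ −3`" (L245–L247), (Sel) = "the `ℤ_p`-corank of `Sel_{p^∞}(E/K)` is
  `1`" (L299–L301); standing: "`E/ℚ` an elliptic curve and `p > 2` an Eisenstein prime [of good
  reduction] for `E`" (L195, L205, L238–L240) = Theorem C of the Introduction (L304–L309, the same
  hypotheses). The body's setting "as in §3.2" (L1253–L1257: "`p ∤ 2N` a prime of good ordinary
  reduction", "`K` … of discriminant `D_K` prime to `Np`", "(h1) `E(K)[p] = 0`") is implied by these:
  ordinary ⇐ Eisenstein (Intro L195, "by a result of Fontaine"; tree `goodOrd_of_red_of_good`),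
  `(D_K, Np) = 1` ⇐ (Heeg) + (spl), and (h1) ⇐ `φ|_{G_p} ≠ 𝟙, ω` with (spl) ("The hypotheses on `φ`
  imply that `E(K)[p] = 0`", proof of Thm. 5.3.1, L2630). Proof of 4.2.2 (L2343–L2357): Thm. 4.1.2 +
  Rem. 4.1.3 + Prop. 4.2.1 ([BCK] Thm. 5.2) + Thm. 2.2.3 (`μ`, `λ`). No Beilinson–Flach input.
* **Theorem 5.1.3** (TeX `thmpadicGZ`, L2463–L2471), §5.1.2 "Gross–Zagier formulae", with its data
  (L2434–L2447): "Let `E/ℚ` be an elliptic curve of conductor `N`, and fix a parametrization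
  `π : X₀(N) → E`. Let `K` be an imaginary quadratic field satisfying the Heegner hypothesis relative
  to `N`, and fix an integral ideal `𝔑 ⊂ 𝓞_K` with `𝓞_K/𝔑 = ℤ/Nℤ`. Let `x₁ = [ℂ/𝓞_K → ℂ/𝔑⁻¹] ∈
  X₀(N)` be the Heegner point of conductor `1` on `X₀(N)`, which is defined over the Hilbert class
  field `H = K[1]` of `K`, and set `P_K = Σ_{σ ∈ Gal(H/K)} π(x₁)^σ ∈ E(K)`. … Let also `ω_E` be a
  Néron differential on `E`, and let `c_E ∈ ℤ` be the associated Manin constant, so that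
  `π^*(ω_E) = c_E · ω_f`." — "**Theorem 5.1.3.** Under the above hypotheses, let `p > 2` be a prime
  of good reduction for `E` such that `p = v v̄` splits in `K`. Then
  `𝓛_E(0) = c_E⁻² · (1 − a_p p⁻¹ + p⁻¹)² · log_{ω_E}(P_K)²`, where `log_{ω_E} : E(K_v) → K_v` is the
  formal group logarithm associated to `ω_E`." Proof (L2474–L2481): BDP Thm. 5.13 at `k = 2`,
  `r = j = 0`, `χ = N_K⁻¹`, and `log_{ω_f}(Δ₁) = c_E⁻¹ · log_{ω_E}(π(Δ₁))`.
* **Display (5.4)** (TeX `eq:thmA`, L2622–L2629) in the proof of Thm. 5.3.1, verbatim with its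
  lead-in: "In particular, (Sel) holds, and so all the hypotheses of Theorem 4.2.2 are satisfied.
  Thus there is a `p`-adic unit `u ∈ (ℤ_p^ur)^×` for which (5.4) `𝓕_E(0) = u · 𝓛_E(0)`, where
  `𝓕_E ∈ Λ` is a generator of `char_Λ(𝔛_E)`." — and its use: "Theorem 5.1.1 applies with `P = P_K`,
  which combined with Theorem 5.1.3 and the relations (eq:comparison) and (5.4) yields the equality
  (5.5)". [(5.4) ⇐ Thm. 4.2.2 is one line: two generators of the same principal ideal of the domain
  `Λ^ur` differ by a unit of `Λ^ur`, whose constant term is a unit of `ℤ_p^ur`.]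
* Second citation: Castella–Grossi–Skinner, Math. Ann. **393** (2025) = arXiv:2303.04373 (final TeX
  `HOME/…/src/cgs25-final/`, L3246–L3254), **Thm. 5.5.3**: the conclusion of Thm. 4.2.2 WITHOUT
  (Sel) ("Suppose `K` satisfies hypotheses (Heeg), (spl), and (disc), and that `E[p]^{ss} = 𝔽_p(φ) ⊕
  𝔽_p(ψ)` … with `φ|_{G_p} ≠ 𝟙, ω`. Then `𝔛_Gr(E/K_∞⁻)` is `Λ`-torsion, and `char_Λ(𝔛_Gr(E/K_∞⁻))Λ^ur
  = (𝓛_p^BDP(f/K))`"), and Thm. D's proof (L607–L609: "In the case `r = 1`, we argue as in [CGLS,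
  Thm. 5.3.1]"). This file keeps CGLS's hypothesis (Sel) (the weaker statement; it holds where (5.5)
  is used, by Kolyvagin).

## Transcription (tree vocabulary; every symbol a Literature object; binders = A170's + A157's)

* "`E/ℚ`, `p > 2` an Eisenstein prime of good reduction, `E[p]^{ss} = 𝔽_p(φ) ⊕ 𝔽_p(ψ)` with
  `φ|_{G_p} ≠ 𝟙, ω`" = a globally minimal `W` (so `a_p = W.frobeniusTrace p` and
  `ω = dx/(2y + a₁x + a₃)` IS a Néron differential `ω_E`), `2 < p`, `Good W p`, `Red W p`,
  `¬ Anom W p` — the cell's PROVED dictionary (`Rank1Residual.not_anom_iff_cgs_of_mem_primesAbove`: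
  the condition is symmetric in `{φ, ψ = ωφ⁻¹}` and reads `a_p ≢ 1 (mod p)`), as in A47/A52/A142/
  A149/A157; ordinarity is automatic (`goodOrd_of_red_of_good`).
* `K`: `IsImaginaryQuadratic K`; (Heeg) `SatisfiesHeegnerHypothesis (W.conductorNorm ℤ) K`; (spl)
  `SatisfiesHeegnerHypothesis p K`; (disc) `Odd (discr K) ∧ discr K ≠ -3`; (Sel)
  `(W.baseChange K).selmerCorank p = 1` (`corank_{ℤ_p} Sel_{p^∞}(E/K)`, `Selmer.lean`).
* "`ι_p`, `v` induced by `ι_p`, `v̄`", "`Γ`, `γ`, `Λ = ℤ_p⟦T⟧`", "`𝔛_E`": EXACTLY the binders of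
  `thm511_anticyclotomicControl` (A170): `ι : K →+* ℚ_[p]`, `v` with `x ∈ v ⟺ ‖ι x‖ < 1`, `vbar ∋ p`,
  `vbar ≠ v`; `κ` anticyclotomic with topological generator `γ`; `𝔛_E = AcSelmer.XAc (W.baseChange K)
  p κ vbar ∅ γ` (strict at `v̄`, relaxed at `v`; `K_∞`-formulation), `Λ = IwasawaAlgebra p`.
* "`π : X₀(N) → E`, `c_E`, `𝔑`, `P_K`": EXACTLY the binders of `display55_sha_heegnerIndex` (A157):
  a parametrisation datum `Dt : ModularParametrizationData W N` (its field `Dt.c ∈ ℤ` IS the Manin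
  constant of `π = φ_Dt`: "the pull-back of the Néron differential is `c · 2πi f(τ) dτ`",
  `ModularCurve.lean`; `N = N_E` by `Dt.isNewformOf` and Carayol/modularity), a Heegner datum
  `H : HeegnerDatum N (discr K)` (the ideal `𝔑`), an embedding `ιC : K →+* ℂ` and `P ∈ E(K)` with
  `ιC(P) = heegnerPointComplex Dt H = Σ_{[𝔞]} φ_Dt(τ_𝔞) = P_K` (`HeegnerPoints.lean`).
* "`log_{ω_E}(P_K)`, `log_{ω_E} : E(K_v) → K_v`" (`K_v = ℚ_p`, `v` induced by `ι_p`): the READING of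
  `PadicFormalLogOrder.lean` at the element level — `P_ι = padicPointOf W p ι P ∈ E(ℚ_p)`,
  `m₀ = formalIndex W p = [E(ℚ_p) : E₁(ℚ_p)]`, and `log_{ω_E}(P) = log_W(z(m₀ • P_ι)) / m₀` with
  `log_W ∘ z = (W.baseChange ℚ_[p]).padicLogPoint` the formal-group logarithm on `E₁(ℚ_p)` for the
  `p`-minimal equation `W` (AEC IV.6.4 / VII.2.2) — the unique homomorphic extension of the formal
  logarithm to `E(ℚ_p)`; its valuation is `padicLogOrd W p ι P` by definition.
* "`u ∈ (ℤ_p^ur)^×`" and the ring of the identity: `𝓕_E(0) ∈ ℤ_p` and, by Thm. 5.1.3,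
  `𝓛_E(0) = c_E⁻²(1 − a_p p⁻¹ + p⁻¹)² log_{ω_E}(P_K)² ∈ K_v = ℚ_p`; when this value is non-zero,
  `u = 𝓕_E(0)/𝓛_E(0) ∈ ℚ_p ∩ (ℤ_p^ur)^× = ℤ_p^×` (the unramified extension does not change absolute
  values on `ℚ_p`), and when it is zero `𝓕_E(0) = 0` and `u := 1` serves. So the printed pair
  ((5.4), Thm. 5.1.3) yields VERBATIM the identity below in `ℚ_p` with `u ∈ ℤ_p^×` — no object for
  `Λ^ur` or `𝓛_E` is needed, and none is introduced.
* "`𝔛_E` is `Λ`-torsion, … `𝓕_E ∈ Λ` a generator of `char_Λ(𝔛_E)`": `Module.IsTorsion Λ 𝔛_E` and the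
  existence of a generator `F` of `AcSelmer.XAc.charIdeal …` with the property (as in A170); that
  the property then holds for EVERY generator is PROVED below.

## Contents

* `display54_thm513_generator_constantCoeff` — the named fact (ONE new `def … : Prop`).
* PROVED: `generator_constantCoeff_eq_of_display54` (every generator satisfies the identity, with
  its own unit), `valuation_generator_constantCoeff_of_display54` (the identity in valuations:
  `ord_p 𝓕_E(0) = 2·(ord_p(1 − a_p + p) − 1 + ord_p log_{ω_E} P_K) − 2·ord_p c_E` for every generator
  with `𝓕_E(0) ≠ 0` — the currency of A170 and of the cell's `HasCharValuationAt`),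
  `hasCharValuationAt_of_display54` (the packaged shape `∃ n, AcSelmer.XAc.HasCharValuationAt … n ∧
  n = …` — LITERALLY the body shape of lit-glue's Summits predicate `X11b.IMCWaldspurgerOnTreeGoodAt`
  up to the Manin term and the log-prime convention).

## References
* [CastellaGrossiLeeSkinner2022] Invent. Math. 227 (2022) = arXiv:2008.02571v2: Thm. 4.2.2
  (L2332–L2357), Thm. 5.1.3 with §5.1.2 (L2432–L2481), proof of Thm. 5.3.1, (5.4) (L2616–L2634);
  Thm. 2.1.1 (`𝓛_E`, L959–L966); Intro (Λ^ur, L205–L216).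
* [CastellaGrossiSkinner2025] Math. Ann. 393 (2025): Thm. 5.5.3 (no (Sel)), Thm. D (proof).
* [BertoliniDarmonPrasanna2013] Duke Math. J. 162: Thm. 5.13 (the source of Thm. 5.1.3).
* Tree: `AnticyclotomicControl.lean` (A170, Thm. 5.1.1), `HeegnerIndexIdentity.lean` (A157, (5.5)),
  `Castella2018/AnticyclotomicSelmerDual.lean` (`XAc`), `PadicFormalLogOrder.lean` (the log reading);
  HOME/CITED-FACTS.md A157/A170; HOME/b2b-bsdres-lit-cgls/CGLS-GV-TYPING.md §13 (session 6).
-/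

set_option autoImplicit false

noncomputable section

open scoped Classical

open WeierstrassCurve NumberField IsDedekindDomain Field Literature.NumberTheory.EllipticCurves
  Literature.NumberTheory.EllipticCurves.ModularForms Literature.NumberTheory.QuadraticFields
  Literature.NumberTheory.EllipticCurves.Rank1Residual
  Literature.NumberTheory.EllipticCurves.Castella2018

namespace Literature.NumberTheory.EllipticCurves.CastellaGrossiLeeSkinner2022

/-- **Castella–Grossi–Lee–Skinner, Invent. Math. 227 (2022) = arXiv:2008.02571v2 (final): Theorem
4.2.2 at the trivial character — display (5.4) of the proof of Theorem 5.3.1 — combined with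
Theorem 5.1.3 (the Bertolini–Darmon–Prasanna formula), as the printed proof combines them.**
Thm. 4.2.2 (verbatim): "Suppose `K` satisfies hypotheses (Heeg), (spl), (disc), and (Sel), and that
`E[p]^{ss} = 𝔽_p(φ) ⊕ 𝔽_p(ψ)` as `G_ℚ`-modules, with `φ|_{G_p} ≠ 𝟙, ω`. Then `𝔛_E` is `Λ`-torsion,
and `char_Λ(𝔛_E)Λ^ur = (𝓛_E)` as ideals in `Λ^ur`" (`E/ℚ` elliptic, `p > 2` an Eisenstein prime of
good reduction; `𝓛_E ∈ Λ^ur = Λ ⊗̂ ℤ_p^ur` the BDP `p`-adic `L`-function of Thm. 2.1.1; `𝔛_E` the dual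
of the Selmer group over the anticyclotomic tower relaxed above `v`, strict above `v̄`, `v` the prime
induced by the fixed `ι_p`). Proof of Thm. 5.3.1 (verbatim): "all the hypotheses of Theorem 4.2.2
are satisfied. Thus there is a `p`-adic unit `u ∈ (ℤ_p^ur)^×` for which (5.4) `𝓕_E(0) = u · 𝓛_E(0)`,
where `𝓕_E ∈ Λ` is a generator of `char_Λ(𝔛_E)`." Thm. 5.1.3 (verbatim, data of §5.1.2: `E/ℚ` of
conductor `N`, a parametrization `π : X₀(N) → E`, `K` imaginary quadratic with the Heegner
hypothesis relative to `N`, `𝔑 ⊂ 𝓞_K` with `𝓞_K/𝔑 = ℤ/Nℤ`, `P_K = Σ_{σ ∈ Gal(H/K)} π(x₁)^σ ∈ E(K)`,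
`c_E ∈ ℤ` the Manin constant, `π^*(ω_E) = c_E · ω_f`): "let `p > 2` be a prime of good reduction for
`E` such that `p = v v̄` splits in `K`. Then `𝓛_E(0) = c_E⁻² · (1 − a_p p⁻¹ + p⁻¹)² · log_{ω_E}(P_K)²`,
where `log_{ω_E} : E(K_v) → K_v` is the formal group logarithm associated to `ω_E`." COMBINED (the
proof: "Theorem 5.1.1 applies with `P = P_K`, which combined with Theorem 5.1.3 and the relations
(eq:comparison) and (5.4) yields (5.5)"): `𝓕_E(0) = u · c_E⁻² (1 − a_p p⁻¹ + p⁻¹)² log_{ω_E}(P_K)²`,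
an identity in `K_v = ℚ_p` (`𝓕_E(0) ∈ ℤ_p`, the right-hand factor in `ℚ_p`), so that `u ∈ ℚ_p ∩
(ℤ_p^ur)^× = ℤ_p^×` whenever the value is non-zero (and `u := 1` serves when it is zero).
TRANSCRIBED (module docstring for the dictionary): `W` globally minimal, `2 < p`, `Good W p`,
`Red W p`, `¬ Anom W p`; `K` imaginary quadratic with (Heeg) for `N_E`, (spl), (disc) `D_K` odd
`≠ −3`, (Sel) `corank_{ℤ_p} Sel_{p^∞}(E/K) = 1`; `(ι, v, vbar, κ, γ)` and `𝔛_E = AcSelmer.XAc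
(W.baseChange K) p κ vbar ∅ γ` exactly as in `thm511_anticyclotomicControl`; `(Dt, H, ιC, P)` exactly
as in `display55_sha_heegnerIndex` (`Dt.c = c_E`, `ιC(P) = P_K`); `log_{ω_E}(P_K) = log_W(z(m₀ •
P_ι))/m₀` (`padicLogPoint`, `formalIndex`, `padicPointOf` of `PadicFormalLogOrder.lean`);
conclusion: `𝔛_E` is `Λ`-torsion and there is a generator `F` of `char_Λ(𝔛_E)` and `u ∈ ℤ_p^×` with
`F(0) = u · c_E⁻² · (1 − a_p p⁻¹ + p⁻¹)² · log_{ω_E}(P_K)²` in `ℚ_p`. COMPOSITE OF TWO PRINTED,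
PUBLISHED THEOREMS of one paper, assembled as its own proof assembles them; nothing asserted.
[cite: CastellaGrossiLeeSkinner2022, Thm. 4.2.2 (arXiv v2 TeX L2332–L2341) and proof of Thm. 5.3.1, display (5.4) (TeX `eq:thmA`, L2622–L2629)]
[cite: CastellaGrossiLeeSkinner2022, Thm. 5.1.3 (TeX `thmpadicGZ`, L2463–L2471) with §5.1.2 (L2434–L2447)]
[cite: CastellaGrossiSkinner2025, Thm. 5.5.3 (the same equality of ideals without (Sel)) and proof of Thm. D ("we argue as in [CGLS, Thm. 5.3.1]")]
[cite: BertoliniDarmonPrasanna2013, Thm. 5.13 (the source of Thm. 5.1.3)] -/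
def display54_thm513_generator_constantCoeff : Prop :=
  ∀ (W : WeierstrassCurve ℚ) [W.IsElliptic] [W.IsGloballyMinimal] (p : ℕ) [Fact p.Prime],
    2 < p → Good W p → Red W p → ¬ Anom W p →
    ∀ (K : Type) [Field K] [NumberField K], IsImaginaryQuadratic K →
      SatisfiesHeegnerHypothesis (W.conductorNorm ℤ) K → SatisfiesHeegnerHypothesis p K →
      Odd (NumberField.discr K) → NumberField.discr K ≠ -3 →
      (W.baseChange K).selmerCorank p = 1 →
    ∀ (ι : K →+* ℚ_[p]) (v vbar : HeightOneSpectrum (𝓞 K)),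
      (∀ x : 𝓞 K, x ∈ v.asIdeal ↔ ‖ι (x : K)‖ < 1) →
      ((p : ℕ) : 𝓞 K) ∈ vbar.asIdeal → vbar ≠ v →
    ∀ (κ : ZpExtension K p), κ.IsAnticyclotomic →
    ∀ (γ : absoluteGaloisGroup K) [Fact (κ.IsTopGenerator γ)],
    ∀ (N : ℕ) [NeZero N] (Dt : ModularParametrizationData W N)
      (H : HeegnerDatum N (NumberField.discr K)) (ιC : K →+* ℂ) (P : (W.baseChange K).toAffine.Point),
      WeierstrassCurve.Affine.Point.map ιC.toRatAlgHom P = heegnerPointComplex Dt H →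
      Module.IsTorsion (IwasawaAlgebra p) (AcSelmer.XAc (W.baseChange K) p κ vbar ∅ γ) ∧
      ∃ F : IwasawaAlgebra p,
        AcSelmer.XAc.charIdeal (W.baseChange K) p κ vbar ∅ γ = Ideal.span {F} ∧
        ∃ u : ℤ_[p]ˣ,
          ((PowerSeries.constantCoeff F : ℤ_[p]) : ℚ_[p]) =
            ((u : ℤ_[p]) : ℚ_[p]) * ((Dt.c : ℚ_[p])⁻¹) ^ 2 *
              (1 - (W.frobeniusTrace p : ℚ_[p]) * (p : ℚ_[p])⁻¹ + (p : ℚ_[p])⁻¹) ^ 2 *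
              ((W.baseChange ℚ_[p]).padicLogPoint (formalIndex W p • padicPointOf W p ι P) /
                (formalIndex W p : ℚ_[p])) ^ 2

/-! ### A `p`-adic valuation computation (standard API; no mathematical content of its own) -/

section Valuation

variable {p : ℕ} [hp : Fact p.Prime]

/-- `ord_p` of the right-hand side of (5.4) ∘ Thm. 5.1.3: for a unit `u ∈ ℤ_p^×`, integers `c, a`,
`L ∈ ℚ_p` and `m ∈ ℕ`, if `u · c⁻² · (1 − a p⁻¹ + p⁻¹)² · (L/m)² ≠ 0` then its valuation is
`2·(ord_p(1 − a + p) − 1 + (ord_p L − ord_p m)) − 2·ord_p c` (each factor is non-zero, `ord_p` is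
additive, `1 − a p⁻¹ + p⁻¹ = (1 − a + p)/p`). Private helper. [folklore] -/
private theorem valuation_unit_mul_bdpShape (u : ℤ_[p]ˣ) (c a : ℤ) (L : ℚ_[p]) (m : ℕ)
    (h : ((u : ℤ_[p]) : ℚ_[p]) * ((c : ℚ_[p])⁻¹) ^ 2 *
        (1 - (a : ℚ_[p]) * (p : ℚ_[p])⁻¹ + (p : ℚ_[p])⁻¹) ^ 2 * (L / (m : ℚ_[p])) ^ 2 ≠ 0) :
    (((u : ℤ_[p]) : ℚ_[p]) * ((c : ℚ_[p])⁻¹) ^ 2 *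
        (1 - (a : ℚ_[p]) * (p : ℚ_[p])⁻¹ + (p : ℚ_[p])⁻¹) ^ 2 * (L / (m : ℚ_[p])) ^ 2).valuation =
      2 * ((padicValInt p (1 - a + p) : ℤ) - 1 + (L.valuation - (padicValNat p m : ℤ))) -
        2 * (padicValInt p c : ℤ) := by
  have hp0 : (p : ℚ_[p]) ≠ 0 := by exact_mod_cast hp.out.ne_zero
  have hu0 : ((u : ℤ_[p]) : ℚ_[p]) ≠ 0 := PadicInt.coe_ne_zero.2 u.ne_zero
  have hc0 : ((c : ℚ_[p])⁻¹) ≠ 0 := by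
    intro h0; apply h; rw [h0]; ring
  have hA0 : (1 - (a : ℚ_[p]) * (p : ℚ_[p])⁻¹ + (p : ℚ_[p])⁻¹) ≠ 0 := by
    intro h0; apply h; rw [h0]; ring
  have hLm0 : L / (m : ℚ_[p]) ≠ 0 := by
    intro h0; apply h; rw [h0]; ring
  have hL0 : L ≠ 0 := by
    intro h0; apply hLm0; rw [h0, zero_div]
  have hm0 : (m : ℚ_[p]) ≠ 0 := by
    intro h0; apply hLm0; rw [h0, div_zero]
  -- `1 − a p⁻¹ + p⁻¹ = (1 − a + p)/p`
  have hAeq : (1 - (a : ℚ_[p]) * (p : ℚ_[p])⁻¹ + (p : ℚ_[p])⁻¹) =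
      ((1 - a + p : ℤ) : ℚ_[p]) * (p : ℚ_[p])⁻¹ := by
    push_cast
    field_simp
    ring
  have hA1 : ((1 - a + p : ℤ) : ℚ_[p]) ≠ 0 := by
    intro h0; apply hA0; rw [hAeq, h0, zero_mul]
  -- valuations of the four factors
  have hvu : ((u : ℤ_[p]) : ℚ_[p]).valuation = 0 := by
    simp only [PadicInt.valuation_coe, padicInt_valuation_eq_zero_of_isUnit u.isUnit, Nat.cast_zero]
  have hvc : ((c : ℚ_[p])⁻¹).valuation = -(padicValInt p c : ℤ) := by
    rw [Padic.valuation_inv, Padic.valuation_intCast]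
  have hvA : (1 - (a : ℚ_[p]) * (p : ℚ_[p])⁻¹ + (p : ℚ_[p])⁻¹).valuation =
      (padicValInt p (1 - a + p) : ℤ) - 1 := by
    rw [hAeq, Padic.valuation_mul hA1 (inv_ne_zero hp0), Padic.valuation_intCast,
      Padic.valuation_inv, Padic.valuation_p]
    ring
  have hvL : (L / (m : ℚ_[p])).valuation = L.valuation - (padicValNat p m : ℤ) := by
    rw [div_eq_mul_inv, Padic.valuation_mul hL0 (inv_ne_zero hm0), Padic.valuation_inv,
      Padic.valuation_natCast]
    ring
  rw [Padic.valuation_mul (mul_ne_zero (mul_ne_zero hu0 (pow_ne_zero 2 hc0)) (pow_ne_zero 2 hA0))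
      (pow_ne_zero 2 hLm0),
    Padic.valuation_mul (mul_ne_zero hu0 (pow_ne_zero 2 hc0)) (pow_ne_zero 2 hA0),
    Padic.valuation_mul hu0 (pow_ne_zero 2 hc0), Padic.valuation_pow, Padic.valuation_pow,
    Padic.valuation_pow, hvu, hvc, hvA, hvL]
  ring

end Valuation

variable {W : WeierstrassCurve ℚ} [W.IsElliptic] [W.IsGloballyMinimal] {p : ℕ} [Fact p.Prime]

/-! ### Bookkeeping consumers -/

/-- **Every generator satisfies the identity (with its own unit).** Granted the fact, if
`char_Λ(𝔛_E) = (𝓖)` for ANY `𝓖 ∈ Λ`, then `𝓖(0) = u' · c_E⁻² (1 − a_p p⁻¹ + p⁻¹)² log_{ω_E}(P_K)²` for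
some `u' ∈ ℤ_p^×`: two generators of a principal ideal of the domain `Λ = ℤ_p⟦T⟧` differ by a unit of
`Λ`, whose constant term is a unit of `ℤ_p` ("letting `𝓕_E` be a generator" is generator-independent).
[cite: CastellaGrossiLeeSkinner2022, proof of Thm. 5.3.1, display (5.4)] -/
theorem generator_constantCoeff_eq_of_display54 (h : display54_thm513_generator_constantCoeff)
    (hp : 2 < p) (hgood : Good W p) (hred : Red W p) (hna : ¬ Anom W p)
    (K : Type) [Field K] [NumberField K] (hK : IsImaginaryQuadratic K)
    (hHN : SatisfiesHeegnerHypothesis (W.conductorNorm ℤ) K) (hHp : SatisfiesHeegnerHypothesis p K)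
    (hodd : Odd (NumberField.discr K)) (h3 : NumberField.discr K ≠ -3)
    (hSel : (W.baseChange K).selmerCorank p = 1)
    (ι : K →+* ℚ_[p]) (v vbar : HeightOneSpectrum (𝓞 K))
    (hv : ∀ x : 𝓞 K, x ∈ v.asIdeal ↔ ‖ι (x : K)‖ < 1)
    (hvbar : ((p : ℕ) : 𝓞 K) ∈ vbar.asIdeal) (hne : vbar ≠ v)
    (κ : ZpExtension K p) (hκ : κ.IsAnticyclotomic)
    (γ : absoluteGaloisGroup K) [Fact (κ.IsTopGenerator γ)]
    {N : ℕ} [NeZero N] (Dt : ModularParametrizationData W N)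
    (H : HeegnerDatum N (NumberField.discr K)) (ιC : K →+* ℂ) (P : (W.baseChange K).toAffine.Point)
    (hP : WeierstrassCurve.Affine.Point.map ιC.toRatAlgHom P = heegnerPointComplex Dt H)
    (G : IwasawaAlgebra p) (hG : AcSelmer.XAc.charIdeal (W.baseChange K) p κ vbar ∅ γ = Ideal.span {G}) :
    ∃ u' : ℤ_[p]ˣ,
      ((PowerSeries.constantCoeff G : ℤ_[p]) : ℚ_[p]) =
        ((u' : ℤ_[p]) : ℚ_[p]) * ((Dt.c : ℚ_[p])⁻¹) ^ 2 *
          (1 - (W.frobeniusTrace p : ℚ_[p]) * (p : ℚ_[p])⁻¹ + (p : ℚ_[p])⁻¹) ^ 2 *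
          ((W.baseChange ℚ_[p]).padicLogPoint (formalIndex W p • padicPointOf W p ι P) /
            (formalIndex W p : ℚ_[p])) ^ 2 := by
  obtain ⟨-, F, hF, u, hu⟩ :=
    h W p hp hgood hred hna K hK hHN hHp hodd h3 hSel ι v vbar hv hvbar hne κ hκ γ N Dt H ιC P hP
  -- `G = F · w` for a unit `w` of `Λ`; `w(0)` is a unit of `ℤ_p`
  obtain ⟨w, rfl⟩ := Ideal.span_singleton_eq_span_singleton.mp (hF.symm.trans hG)
  have hw : IsUnit (PowerSeries.constantCoeff (w : IwasawaAlgebra p)) :=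
    PowerSeries.isUnit_constantCoeff _ w.isUnit
  refine ⟨u * hw.unit, ?_⟩
  rw [map_mul, PadicInt.coe_mul, hu, Units.val_mul, PadicInt.coe_mul, IsUnit.unit_spec]
  ring

/-- **The identity in valuations** — the currency of Thm. 5.1.1 (A170) and of the cell's
`AcSelmer.XAc.HasCharValuationAt`: granted the fact, for EVERY generator `𝓖` of `char_Λ(𝔛_E)` with
`𝓖(0) ≠ 0`, `ord_p 𝓖(0) = 2·(ord_p(1 − a_p + p) − 1 + ord_p log_{ω_E} P_K) − 2·ord_p c_E`, where
`ord_p log_{ω_E} P_K = padicLogOrd W p ι P` (`= ord_p log_W(z(m₀ • P_ι)) − ord_p m₀`) and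
`ord_p(1 − a_p p⁻¹ + p⁻¹) = ord_p(1 − a_p + p) − 1`. (From `𝓖(0) ≠ 0` every factor of the right-hand
side is non-zero, so `ord_p` is additive.) [cite: CastellaGrossiLeeSkinner2022, proof of Thm. 5.3.1, display (5.4) with Thm. 5.1.3] -/
theorem valuation_generator_constantCoeff_of_display54 (h : display54_thm513_generator_constantCoeff)
    (hp : 2 < p) (hgood : Good W p) (hred : Red W p) (hna : ¬ Anom W p)
    (K : Type) [Field K] [NumberField K] (hK : IsImaginaryQuadratic K)
    (hHN : SatisfiesHeegnerHypothesis (W.conductorNorm ℤ) K) (hHp : SatisfiesHeegnerHypothesis p K)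
    (hodd : Odd (NumberField.discr K)) (h3 : NumberField.discr K ≠ -3)
    (hSel : (W.baseChange K).selmerCorank p = 1)
    (ι : K →+* ℚ_[p]) (v vbar : HeightOneSpectrum (𝓞 K))
    (hv : ∀ x : 𝓞 K, x ∈ v.asIdeal ↔ ‖ι (x : K)‖ < 1)
    (hvbar : ((p : ℕ) : 𝓞 K) ∈ vbar.asIdeal) (hne : vbar ≠ v)
    (κ : ZpExtension K p) (hκ : κ.IsAnticyclotomic)
    (γ : absoluteGaloisGroup K) [Fact (κ.IsTopGenerator γ)]
    {N : ℕ} [NeZero N] (Dt : ModularParametrizationData W N)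
    (H : HeegnerDatum N (NumberField.discr K)) (ιC : K →+* ℂ) (P : (W.baseChange K).toAffine.Point)
    (hP : WeierstrassCurve.Affine.Point.map ιC.toRatAlgHom P = heegnerPointComplex Dt H)
    (G : IwasawaAlgebra p) (hG : AcSelmer.XAc.charIdeal (W.baseChange K) p κ vbar ∅ γ = Ideal.span {G})
    (hG0 : PowerSeries.constantCoeff G ≠ 0) :
    ((PowerSeries.constantCoeff G).valuation : ℤ) =
      2 * ((padicValInt p (1 - W.frobeniusTrace p + p) : ℤ) - 1 + padicLogOrd W p ι P) -
        2 * (padicValInt p Dt.c : ℤ) := by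
  obtain ⟨u', hu'⟩ := generator_constantCoeff_eq_of_display54 h hp hgood hred hna K hK hHN hHp hodd h3
    hSel ι v vbar hv hvbar hne κ hκ γ Dt H ιC P hP G hG
  -- the left-hand side is non-zero, hence so is the right-hand side
  have hrhs : ((u' : ℤ_[p]) : ℚ_[p]) * ((Dt.c : ℚ_[p])⁻¹) ^ 2 *
      (1 - (W.frobeniusTrace p : ℚ_[p]) * (p : ℚ_[p])⁻¹ + (p : ℚ_[p])⁻¹) ^ 2 *
      ((W.baseChange ℚ_[p]).padicLogPoint (formalIndex W p • padicPointOf W p ι P) /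
        (formalIndex W p : ℚ_[p])) ^ 2 ≠ 0 := by
    rw [← hu']
    exact PadicInt.coe_ne_zero.2 hG0
  have hval := congrArg Padic.valuation hu'
  rw [PadicInt.valuation_coe, valuation_unit_mul_bdpShape u' Dt.c (W.frobeniusTrace p) _ _ hrhs] at hval
  rw [hval, padicLogOrd]

/-- **Thm. 4.2.2 ∘ Thm. 5.1.3 at the trivial character in the packaged currency**
`AcSelmer.XAc.HasCharValuationAt … n` ("`𝔛_E` is `Λ`-torsion with a generator `𝓕`, `𝓕(0) ≠ 0`,
`ord_p 𝓕(0) = n`") `∧ n = 2·(ord_p(1 − a_p + p) − 1 + ord_p log_{ω_E} P_K) − 2·ord_p c_E` — granted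
the fact and ONE generator with non-zero constant term (at the cell's data this comes from
Thm. 5.1.1 = A170, or from `P_K` non-torsion). Up to the Manin term `2·ord_p c_E` (absent for a
parametrisation with `p ∤ c_E`) and the log-prime convention (here CGLS's: log at the prime `v`
induced by `ι`, `𝔛_E` strict at `v̄`) this is LITERALLY the body of the cell's Summits predicate
`X11b.IMCWaldspurgerOnTreeGoodAt p κ vbar γ ι P` ((IMC∘BDP)ᵍ at `𝟙`), now fed, at a good
non-anomalous Eisenstein `p`, by a published fact.
[cite: CastellaGrossiLeeSkinner2022, Thm. 4.2.2, Thm. 5.1.3, proof of Thm. 5.3.1 (5.4)]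
[cite: Castella2018, §5 (eq:IMC+BDP) (arXiv:1704.06608 p. 12) (the same shape at `p ∣ N`)] -/
theorem hasCharValuationAt_of_display54 (h : display54_thm513_generator_constantCoeff)
    (hp : 2 < p) (hgood : Good W p) (hred : Red W p) (hna : ¬ Anom W p)
    (K : Type) [Field K] [NumberField K] (hK : IsImaginaryQuadratic K)
    (hHN : SatisfiesHeegnerHypothesis (W.conductorNorm ℤ) K) (hHp : SatisfiesHeegnerHypothesis p K)
    (hodd : Odd (NumberField.discr K)) (h3 : NumberField.discr K ≠ -3)
    (hSel : (W.baseChange K).selmerCorank p = 1)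
    (ι : K →+* ℚ_[p]) (v vbar : HeightOneSpectrum (𝓞 K))
    (hv : ∀ x : 𝓞 K, x ∈ v.asIdeal ↔ ‖ι (x : K)‖ < 1)
    (hvbar : ((p : ℕ) : 𝓞 K) ∈ vbar.asIdeal) (hne : vbar ≠ v)
    (κ : ZpExtension K p) (hκ : κ.IsAnticyclotomic)
    (γ : absoluteGaloisGroup K) [Fact (κ.IsTopGenerator γ)]
    {N : ℕ} [NeZero N] (Dt : ModularParametrizationData W N)
    (H : HeegnerDatum N (NumberField.discr K)) (ιC : K →+* ℂ) (P : (W.baseChange K).toAffine.Point)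
    (hP : WeierstrassCurve.Affine.Point.map ιC.toRatAlgHom P = heegnerPointComplex Dt H)
    (G : IwasawaAlgebra p) (hG : AcSelmer.XAc.charIdeal (W.baseChange K) p κ vbar ∅ γ = Ideal.span {G})
    (hG0 : PowerSeries.constantCoeff G ≠ 0) :
    ∃ n : ℕ, AcSelmer.XAc.HasCharValuationAt (W.baseChange K) p κ vbar ∅ γ n ∧
      (n : ℤ) = 2 * ((padicValInt p (1 - W.frobeniusTrace p + p) : ℤ) - 1 + padicLogOrd W p ι P) -
        2 * (padicValInt p Dt.c : ℤ) := by
  obtain ⟨htors, -⟩ :=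
    h W p hp hgood hred hna K hK hHN hHp hodd h3 hSel ι v vbar hv hvbar hne κ hκ γ N Dt H ιC P hP
  exact ⟨(PowerSeries.constantCoeff G).valuation,
    AcSelmer.XAc.hasCharValuationAt_of_eq htors hG hG0 rfl,
    valuation_generator_constantCoeff_of_display54 h hp hgood hred hna K hK hHN hHp hodd h3 hSel ι v
      vbar hv hvbar hne κ hκ γ Dt H ιC P hP G hG hG0⟩

end Literature.NumberTheory.EllipticCurves.CastellaGrossiLeeSkinner2022

end
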